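import Summits.Ventures.CertifiedManyBodySolver.Observables.PairKernelCeilingTL
import HarnessLib

/-!
# The kernel pair-ODLRO ceiling from `D₄`-ORBIT rows (leg-J certificates): every rotated copy of the kernel
# pair word dominates `(Σ Q) · m_d²`

HONEST FRAMING: first certified bounds on pairing observables; not a superconductivity verdict; every
number certified (two lineages + referee) or labelled float. Crew hubbard-obs (D-0042), seat hubbard-obs-p1
(`prover-hubbard-obs-p1-g2-0`), lead ruling (af2). Theorem-only; zero compute; no named fact; no `sorry`.
Companion of `Observables/PairKernelCeilingTL.lean` (plain rows, positive-semidefinite taps `Q`) in the way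
`Observables/PairBoxWordD4.lean` accompanies `PairODLROCeilingTL.lean`: the point-group-reduced certificates
(leg J = SU(2) × D₄, λ-form, `Rows/DopedTLCorrLambdaOrbit.lean`) conclude
`SquareTTPrimeCorrOrbitLowerRow … S Λ_B (−pairKernelWord B Q)`, a bound on the `S`-orbit MEAN of the rotated
copies `Re ω_{γΛ_B}(Γ(d4Emb γ 0 Λ_B)(pairKernelWord B Q))`. Here:

* `expect_d4Emb_pairKernelWord` — `ω(Γ(d4Emb γ w Λ_B)(pairKernelWord B Q)) = Σ_{x,y∈B} Q x y · ω.dWavePairCorr (γx + w) (γy + w)`;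
* `kernel_mul_braggWeight_le_re_expect_d4Emb_pairKernelWord` — for translation-invariant `ω`, any finite
  measure `μ` representing `r ↦ ω.dWavePairCorr 0 r` and taps `Q ⪰ 0` on `B`:
  `(Σ_{x,y∈B} Q x y) · braggWeight μ ![0] ≤ Re ω(Γ(d4Emb γ w Λ_B)(pairKernelWord B Q))` for EVERY `γ, w`
  (the kernel ceiling with the placement `x ↦ γx + w`; positive-semidefiniteness is placement-free);
* `kernel_mul_braggWeight_le_neg_of_pairKernel_orbitLowerRow` / `braggWeight_le_neg_div_…` — an ORBIT row
  `SquareTTPrimeCorrOrbitLowerRow tp U n u r S Λ_B (−pairKernelWord B Q)` (energy cap `u`) gives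
  `(Σ Q) · braggWeight μ ![0] ≤ −r` for every torus-limit ground state of the class with `e₀ ≤ u` and every
  representing `μ`, with NO `D₄`-invariance assumption on `ω`, `B` or `Q`; M3′ form
  `m3_dWavePair_braggWeight_le_of_kernel_orbitLowerRow_neg`.

References: Sewell, J. Math. Phys. 11 (1970) 1868, §4; Scalapino, Phys. Rep. 250 (1995) 329, §2 eq. (2.4);
Capon, Proc. IEEE 57 (1969) 1408.
-/

noncomputable section

open MeasureTheory Complex Filter Topology
open scoped Real BigOperators

namespace Summit.Ventures.CertifiedManyBodySolver.Observables

section OrbitRow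

open Matrix Literature.MathematicalPhysics.QuantumLattice Literature.Probability.LatticeModels
open Literature.MathematicalPhysics.QuantumLattice.HubbardWave0 ThermodynamicLimit
open scoped ComplexOrder


/-- **The rotated kernel pair word**: `ω(Γ(d4Emb γ w Λ_B)(pairKernelWord B Q)) =
Σ_{x,y∈B} Q x y · ω.dWavePairCorr (γx + w) (γy + w)`. [cite: Scalapino1995, §2 eq. (2.4)] -/
theorem expect_d4Emb_pairKernelWord (ω : InfVolFermionState 2) (γ : DihedralGroup 4) (w : Site 2)
    (B : Finset (Site 2)) (Q : Site 2 → Site 2 → ℚ) :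
    ω.expect (d4ShiftSet γ w (B.biUnion (pairRegion (insert (0 : Site 2) unitSteps))))
      (fermionEmbed (PolySite.d4Emb γ w _) (pairKernelWord (insert (0 : Site 2) unitSteps) dWaveFormFactor B Q)) =
      ∑ x ∈ B, ∑ y ∈ B, (((Q x y : ℚ) : ℝ) : ℂ) * ω.dWavePairCorr (d4Vec γ x + w) (d4Vec γ y + w) := by
  unfold pairKernelWord
  rw [map_sum, map_sum]
  have hx : ∀ x ∈ B.attach, ω.expect (d4ShiftSet γ w (B.biUnion (pairRegion (insert (0 : Site 2) unitSteps))))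
      (fermionEmbed (PolySite.d4Emb γ w _) (∑ y ∈ B.attach, (((Q x y : ℚ) : ℝ) : ℂ) •
        (fermionEmbed (PolySite.incl (Finset.subset_biUnion_of_mem (pairRegion (insert (0 : Site 2) unitSteps)) x.2))
            (localPairAt (insert (0 : Site 2) unitSteps) dWaveFormFactor x)ᴴ *
          fermionEmbed (PolySite.incl (Finset.subset_biUnion_of_mem (pairRegion (insert (0 : Site 2) unitSteps)) y.2))
            (localPairAt (insert (0 : Site 2) unitSteps) dWaveFormFactor y)))) =
      ∑ y ∈ B.attach, (((Q x y : ℚ) : ℝ) : ℂ) * ω.dWavePairCorr (d4Vec γ x + w) (d4Vec γ y + w) := by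
    intro x _
    rw [map_sum, map_sum]
    refine Finset.sum_congr rfl fun y _ => ?_
    rw [fermionEmbed_smul, map_smul, smul_eq_mul, expect_d4Emb_pair_mul ω γ w x y _ _]
  rw [Finset.sum_congr rfl hx,
    Finset.sum_attach B (fun x => ∑ y ∈ B.attach,
      (((Q x y : ℚ) : ℝ) : ℂ) * ω.dWavePairCorr (d4Vec γ x + w) (d4Vec γ (y : Site 2) + w))]
  exact Finset.sum_congr rfl fun x _ =>
    Finset.sum_attach B (fun y => (((Q x y : ℚ) : ℝ) : ℂ) * ω.dWavePairCorr (d4Vec γ x + w) (d4Vec γ y + w))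

/-- Real parts: `Re ω(Γ(d4Emb γ w Λ_B)(pairKernelWord B Q)) = Σ_{x,y∈B} Q x y · Re ω.dWavePairCorr (γx + w) (γy + w)`. -/
theorem re_expect_d4Emb_pairKernelWord (ω : InfVolFermionState 2) (γ : DihedralGroup 4) (w : Site 2)
    (B : Finset (Site 2)) (Q : Site 2 → Site 2 → ℚ) :
    (ω.expect (d4ShiftSet γ w (B.biUnion (pairRegion (insert (0 : Site 2) unitSteps))))
      (fermionEmbed (PolySite.d4Emb γ w _)
        (pairKernelWord (insert (0 : Site 2) unitSteps) dWaveFormFactor B Q))).re =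
      ∑ x ∈ B, ∑ y ∈ B, ((Q x y : ℚ) : ℝ) * (ω.dWavePairCorr (d4Vec γ x + w) (d4Vec γ y + w)).re := by
  rw [expect_d4Emb_pairKernelWord, Complex.re_sum]
  refine Finset.sum_congr rfl fun x _ => ?_
  rw [Complex.re_sum]
  exact Finset.sum_congr rfl fun y _ => Complex.re_ofReal_mul _ _

/-- **Every rotated copy of the kernel pair word dominates `(Σ Q) · m_d²`**: for a translation-invariant `ω`,
any finite measure `μ` representing `r ↦ ω.dWavePairCorr 0 r`, every `γ ∈ D₄`, `w ∈ ℤ²`, finite `B` and taps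
`Q` positive semidefinite on `B`: `(Σ_{x,y∈B} Q x y) · braggWeight μ ![0] ≤ Re ω(Γ(d4Emb γ w Λ_B)(pairKernelWord B Q))`
(the kernel ceiling of `PairKernelCeilingTL` §1 with the placement `x ↦ γx + w`). [cite: Sewell1970, §4 (Thm. 4.3)] -/
theorem kernel_mul_braggWeight_le_re_expect_d4Emb_pairKernelWord {ω : InfVolFermionState 2}
    (hω : ω.IsTranslationInvariant) (μ : Measure (EuclideanSpace ℝ (Fin 2))) [IsFiniteMeasure μ]
    (hμ : ∀ r : Site 2, ∫ ξ, exp ((∑ i, (r i : ℝ) * ξ i : ℝ) * I) ∂μ = ω.dWavePairCorr 0 r)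
    (γ : DihedralGroup 4) (w : Site 2) (B : Finset (Site 2)) {Q : Site 2 → Site 2 → ℚ}
    (hQ : ∀ c : Site 2 → ℝ, 0 ≤ ∑ x ∈ B, ∑ y ∈ B, ((Q x y : ℚ) : ℝ) * c x * c y) :
    (∑ x ∈ B, ∑ y ∈ B, ((Q x y : ℚ) : ℝ)) * braggWeight μ ![(0 : Fin 2 → ℝ)] ≤
      (ω.expect (d4ShiftSet γ w (B.biUnion (pairRegion (insert (0 : Site 2) unitSteps))))
        (fermionEmbed (PolySite.d4Emb γ w _)
          (pairKernelWord (insert (0 : Site 2) unitSteps) dWaveFormFactor B Q))).re := by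
  rw [re_expect_d4Emb_pairKernelWord]
  exact kernel_mul_braggWeight_le_sum_re_dWavePairCorr hω μ hμ B (fun x => d4Vec γ x + w)
    (fun x y => ((Q x y : ℚ) : ℝ)) hQ

/-- **Orbit row on `−pairKernelWord B Q` ⇒ kernel pair-ODLRO ceiling.** A `D₄`-orbit LOWER row (label set
`S`, nonempty) on the NEGATED kernel pair word, `SquareTTPrimeCorrOrbitLowerRow tp U n u r S Λ_B (−pairKernelWord B Q)`
(the shape produced by a leg-J λ-form certificate with `λ < 0`), with taps `Q` positive semidefinite on `B`,
gives for every torus-limit ground state of the class with `energyDensityTT' 1 tp U n ≤ u` and every finite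
measure `μ` representing its `d`-wave pair two-point function: `(Σ_{x,y∈B} Q x y) · braggWeight μ ![0] ≤ −r`.
No invariance of `ω`, `B` or `Q` under `D₄` is assumed. [cite: Sewell1970, §4 (Thm. 4.3)] -/
theorem kernel_mul_braggWeight_le_neg_of_pairKernel_orbitLowerRow {tp U n : ℝ} {u r : ℚ}
    {S : Finset (DihedralGroup 4)} (hS : S.Nonempty) {B : Finset (Site 2)} {Q : Site 2 → Site 2 → ℚ}
    (hQ : ∀ c : Site 2 → ℝ, 0 ≤ ∑ x ∈ B, ∑ y ∈ B, ((Q x y : ℚ) : ℝ) * c x * c y)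
    (h : SquareTTPrimeCorrOrbitLowerRow tp U n u r S
      (B.biUnion (pairRegion (insert (0 : Site 2) unitSteps)))
      (-pairKernelWord (insert (0 : Site 2) unitSteps) dWaveFormFactor B Q))
    (ω : InfVolFermionState 2) (Ls : ℕ → ℕ) (ψ : ∀ L, Fock (Orb (FermionTorus 2 L)))
    (hLs : Tendsto Ls atTop atTop)
    (hψ : ∀ j, IsGroundStateInSector (hubbardTorusTT' (Ls j) 1 tp U) (rectN n (Ls j)) 0 (ψ (Ls j)))
    (hψ1 : ∀ j, star (ψ (Ls j)) ⬝ᵥ ψ (Ls j) = 1) (hω : ω.IsTorusLimitOf ψ Ls)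
    (hu : energyDensityTT' 1 tp U n ≤ ((u : ℚ) : ℝ))
    (μ : Measure (EuclideanSpace ℝ (Fin 2))) [IsFiniteMeasure μ]
    (hμ : ∀ r : Site 2, ∫ ξ, exp ((∑ i, (r i : ℝ) * ξ i : ℝ) * I) ∂μ = ω.dWavePairCorr 0 r) :
    (∑ x ∈ B, ∑ y ∈ B, ((Q x y : ℚ) : ℝ)) * braggWeight μ ![(0 : Fin 2 → ℝ)] ≤ -((r : ℚ) : ℝ) := by
  have hrow := h ω Ls ψ hLs hψ hψ1 hω hu
  set Λ' := B.biUnion (pairRegion (insert (0 : Site 2) unitSteps)) with hΛ'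
  set X : FermionOp Λ' := pairKernelWord (insert (0 : Site 2) unitSteps) dWaveFormFactor B Q with hX
  -- each rotated copy dominates `(Σ Q) m²`
  have hdom : ∀ γ ∈ S, (∑ x ∈ B, ∑ y ∈ B, ((Q x y : ℚ) : ℝ)) * braggWeight μ ![(0 : Fin 2 → ℝ)] ≤
      (ω.expect (d4ShiftSet γ 0 Λ') (fermionEmbed (PolySite.d4Emb γ 0 Λ') X)).re :=
    fun γ _ => kernel_mul_braggWeight_le_re_expect_d4Emb_pairKernelWord hω.isTranslationInvariant μ hμ γ 0 B hQ
  -- the orbit mean of the negated words is `−` the orbit mean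
  have hneg : ∑ γ ∈ S, (ω.expect (d4ShiftSet γ 0 Λ') (fermionEmbed (PolySite.d4Emb γ 0 Λ') (-X))).re =
      -∑ γ ∈ S, (ω.expect (d4ShiftSet γ 0 Λ') (fermionEmbed (PolySite.d4Emb γ 0 Λ') X)).re := by
    rw [← Finset.sum_neg_distrib]
    refine Finset.sum_congr rfl fun γ _ => ?_
    rw [map_neg, map_neg, Complex.neg_re]
  rw [hneg] at hrow
  have hcard : (0 : ℝ) < (S.card : ℝ) := by exact_mod_cast hS.card_pos
  have hmean : (S.card : ℝ) * ((∑ x ∈ B, ∑ y ∈ B, ((Q x y : ℚ) : ℝ)) * braggWeight μ ![(0 : Fin 2 → ℝ)]) ≤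
      ∑ γ ∈ S, (ω.expect (d4ShiftSet γ 0 Λ') (fermionEmbed (PolySite.d4Emb γ 0 Λ') X)).re := by
    have := Finset.sum_le_sum hdom
    rwa [Finset.sum_const, nsmul_eq_mul] at this
  have h2 : ∑ γ ∈ S, (ω.expect (d4ShiftSet γ 0 Λ') (fermionEmbed (PolySite.d4Emb γ 0 Λ') X)).re ≤
      -((r : ℚ) : ℝ) * (S.card : ℝ) := by
    have hinv : (S.card : ℝ)⁻¹ * (S.card : ℝ) = 1 := inv_mul_cancel₀ hcard.ne'
    have := mul_le_mul_of_nonneg_right hrow hcard.le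
    rw [mul_comm ((S.card : ℝ)⁻¹), mul_assoc, hinv, mul_one] at this
    linarith
  nlinarith [hmean, h2, hcard]

/-- Normalised: under the same hypotheses with `0 < Σ Q`, `braggWeight μ ![0] ≤ −r / Σ_{x,y∈B} Q x y`. -/
theorem braggWeight_le_neg_div_of_pairKernel_orbitLowerRow {tp U n : ℝ} {u r : ℚ}
    {S : Finset (DihedralGroup 4)} (hS : S.Nonempty) {B : Finset (Site 2)} {Q : Site 2 → Site 2 → ℚ}
    (hQ : ∀ c : Site 2 → ℝ, 0 ≤ ∑ x ∈ B, ∑ y ∈ B, ((Q x y : ℚ) : ℝ) * c x * c y)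
    (hQpos : 0 < ∑ x ∈ B, ∑ y ∈ B, ((Q x y : ℚ) : ℝ))
    (h : SquareTTPrimeCorrOrbitLowerRow tp U n u r S
      (B.biUnion (pairRegion (insert (0 : Site 2) unitSteps)))
      (-pairKernelWord (insert (0 : Site 2) unitSteps) dWaveFormFactor B Q))
    (ω : InfVolFermionState 2) (Ls : ℕ → ℕ) (ψ : ∀ L, Fock (Orb (FermionTorus 2 L)))
    (hLs : Tendsto Ls atTop atTop)
    (hψ : ∀ j, IsGroundStateInSector (hubbardTorusTT' (Ls j) 1 tp U) (rectN n (Ls j)) 0 (ψ (Ls j)))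
    (hψ1 : ∀ j, star (ψ (Ls j)) ⬝ᵥ ψ (Ls j) = 1) (hω : ω.IsTorusLimitOf ψ Ls)
    (hu : energyDensityTT' 1 tp U n ≤ ((u : ℚ) : ℝ))
    (μ : Measure (EuclideanSpace ℝ (Fin 2))) [IsFiniteMeasure μ]
    (hμ : ∀ r : Site 2, ∫ ξ, exp ((∑ i, (r i : ℝ) * ξ i : ℝ) * I) ∂μ = ω.dWavePairCorr 0 r) :
    braggWeight μ ![(0 : Fin 2 → ℝ)] ≤ -((r : ℚ) : ℝ) / ∑ x ∈ B, ∑ y ∈ B, ((Q x y : ℚ) : ℝ) := by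
  rw [le_div_iff₀ hQpos, mul_comm]
  exact kernel_mul_braggWeight_le_neg_of_pairKernel_orbitLowerRow hS hQ h ω Ls ψ hLs hψ hψ1 hω hu μ hμ

/-- **M3′ form, ORBIT row** (`U = 8`, `n = 7/8`, hopping `tp`): an `M3CorrOrbitLowerRow tp u r S Λ_B
(−pairKernelWord B Q)` cell (leg-J certificate, λ-form with `λ < 0`) with positive-semidefinite taps `Q`,
`0 < Σ Q`, and the cap discharged by a typed `M3EnergyUpperRow tp hi`, `hi ≤ u`, gives
`braggWeight μ ![0] ≤ −r / Σ Q` for every torus-limit ground state of the M3′ class and every measure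
representing its `d`-wave pair two-point function. HONEST: a ceiling says nothing about the presence of pairing. -/
theorem m3_dWavePair_braggWeight_le_of_kernel_orbitLowerRow_neg {tp : ℝ} {u hi r : ℚ}
    {S : Finset (DihedralGroup 4)} (hS : S.Nonempty) {B : Finset (Site 2)} {Q : Site 2 → Site 2 → ℚ}
    (hQ : ∀ c : Site 2 → ℝ, 0 ≤ ∑ x ∈ B, ∑ y ∈ B, ((Q x y : ℚ) : ℝ) * c x * c y)
    (hQpos : 0 < ∑ x ∈ B, ∑ y ∈ B, ((Q x y : ℚ) : ℝ))
    (h : M3CorrOrbitLowerRow tp u r S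
      (B.biUnion (pairRegion (insert (0 : Site 2) unitSteps)))
      (-pairKernelWord (insert (0 : Site 2) unitSteps) dWaveFormFactor B Q))
    (hE : M3EnergyUpperRow tp hi) (hhi : hi ≤ u)
    (ω : InfVolFermionState 2) (Ls : ℕ → ℕ) (ψ : ∀ L, Fock (Orb (FermionTorus 2 L)))
    (hLs : Tendsto Ls atTop atTop)
    (hψ : ∀ j, IsGroundStateInSector (hubbardTorusTT' (Ls j) 1 tp 8) (rectN (7 / 8) (Ls j)) 0 (ψ (Ls j)))
    (hψ1 : ∀ j, star (ψ (Ls j)) ⬝ᵥ ψ (Ls j) = 1) (hω : ω.IsTorusLimitOf ψ Ls)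
    (μ : Measure (EuclideanSpace ℝ (Fin 2))) [IsFiniteMeasure μ]
    (hμ : ∀ r : Site 2, ∫ ξ, exp ((∑ i, (r i : ℝ) * ξ i : ℝ) * I) ∂μ = ω.dWavePairCorr 0 r) :
    braggWeight μ ![(0 : Fin 2 → ℝ)] ≤ -((r : ℚ) : ℝ) / ∑ x ∈ B, ∑ y ∈ B, ((Q x y : ℚ) : ℝ) :=
  braggWeight_le_neg_div_of_pairKernel_orbitLowerRow hS hQ hQpos h ω Ls ψ hLs hψ hψ1 hω
    ((show energyDensityTT' 1 tp 8 (7 / 8) ≤ ((hi : ℚ) : ℝ) from hE).trans (by exact_mod_cast hhi)) μ hμ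

end OrbitRow

end Summit.Ventures.CertifiedManyBodySolver.Observables

end
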